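import Literature.NumberTheory.GaloisRepresentations.ContinuousCohomologyConnecting
import HarnessLib

/-!
# Continuous cohomology commutes with directed unions of the coefficients, in degrees `1` and `2`
# (compact group, discrete module; theorems only)

Topic `NumberTheory/GaloisRepresentations`; namespace
`Literature.NumberTheory.GaloisRepresentations.ContinuousRep`; THEOREMS ONLY (no definition, no
named fact, no `sorry`, no instance).  Lane «SUR-Λ» of cell `bsd-eis` (road memo
`SUR-LAMBDA-ROAD-w5g9.md`, brick B1 = the COEFFICIENT-direction twin of the layer-colimit device
`Literature/Algebra/Homology/DiscreteRepLayerColimit*`), `--supports stmt-BirchSwinnertonDyer-19032`.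

Let `G` be a COMPACT topological group acting continuously and `Λ`-linearly on a DISCRETE
`Λ`-module `D` (`ContinuousRep G Λ D`), and let `(N i)_{i ∈ ι}` be a DIRECTED family of
`G`-stable `Λ`-submodules with `D = ⋃ N i` (no finiteness of the `N i` is assumed).  Then, for
Mathlib's continuous cohomology (`continuousCohomology`, continuous homogeneous cochains) and the
maps induced by the inclusions (the tree's `cohomologyMap` = `ContinuousCohomology.map` along the
identity of `G`; definitionally the Greenberg-2016 dictionary's `Hmap` of `Submodule.subtypeL`),
`Hⁿ(G, D) = colim_i Hⁿ(G, N i)` in element form for `n = 1, 2`: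
* every class of `Hⁿ(G, D)` comes from some `Hⁿ(G, N i)` (`exists_cohomologyMap_eq_one/_two`): a
  continuous cocycle on the compact `G` (resp. `G × G`) with values in the discrete `D` has FINITE
  image (`finite_range_of_compactSpace`), which lies in one `N i` (`exists_subset_of_finite`);
* a class of `Hⁿ(G, N i)` dying in `Hⁿ(G, D)` dies in some `Hⁿ(G, N j)`, `N i ≤ N j`
  (`exists_cohomologyMap_eq_zero_one/_two`): the coboundary witness (`v ∈ D`, resp. a continuous
  `1`-cochain `b : G → D`, again of finite image) lies in some `N j`;
* `Hⁿ(b) ∘ Hⁿ(a) = Hⁿ(c)` on classes for pointwise composites `b ∘ a = c`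
  (`cohomologyMap_comp_apply_of_eq_one/_two`; every degree: the tree's
  `cohomologyMap_comp_apply_of_eq`), and two level classes with the same image in `Hⁿ(G, D)` agree
  at a common deeper level (`exists_cohomologyMap_eq_eq_one/_two`).
(Degree `0`, `D^G = ⋃ (N i)^G`, is immediate and not spelled out.)  MORPHISMS ARE SPECIFIED
POINTWISE: the statements quantify over ANY morphism `f : N i → D` of topological representations
with `f m = m` (resp. transition `t : N i → N j` with `t m = m` in `D`), so consumers feed their
own terms (`TopRep.ofHom ⟨(N i).subtypeL, _⟩`, `Hmap … (N i).subtypeL …`) with `fun _ => rfl`.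
The engine is also stated for ONE injective morphism `f : M → D` (`exists_pullback_eq_of_range_subset`,
`exists_pullback₂_eq_of_range_subset`: cocycles with values in `im f` lift along `f`).

This is the compatibility of continuous cohomology of a compact (e.g. profinite) group with direct
limits of discrete coefficients — Serre, *Galois Cohomology* I §2.2 Prop. 8 ("`H^q(G, lim→ A_i) =
lim→ H^q(G, A_i)`"); Neukirch–Schmidt–Wingberg (2008) Prop. 1.5.1 — via the explicit inhomogeneous
cocycles of the tree's `ContinuousH1` / `ContinuousH2`.  Use (road memo §2): `Hⁿ(K_Σ/K, 𝐃) =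
⋃_k im Hⁿ(K_Σ/K, 𝐃[𝔪ᵏ])` for discrete `𝐃 = ⋃_k 𝐃[𝔪ᵏ]` over the compact `G_{K,Σ}`; local twin at
`Γ_{K_v}`.  HONESTY: generic homological algebra; nothing about number fields or BSD is proved here.
AI formalisation, weaker than expert review; the statements are established only by the kernel check.

## References
* J.-P. Serre, *Galois Cohomology* (1997), I §2.2, Prop. 8. [SerreGaloisCohomology1997]
* J. Neukirch, A. Schmidt, K. Wingberg, *Cohomology of Number Fields*, 2nd ed. (2008),
  Prop. 1.5.1. [NeukirchSchmidtWingberg2008]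
-/

noncomputable section

open CategoryTheory Function Set

universe u

namespace Literature.NumberTheory.GaloisRepresentations.ContinuousRep

open _root_.TopRep _root_.ContRepresentation _root_.ContinuousCohomology

/-! ### §0. Two finiteness / directedness facts -/

section Finite

variable {G : Type*} [TopologicalSpace G] [CompactSpace G] {D : Type*} [TopologicalSpace D]
  [DiscreteTopology D]

/-- A continuous map from a compact space to a discrete space has finite image (Serre I §2.2:
a continuous cochain with values in a discrete module takes finitely many values).
[cite: SerreGaloisCohomology1997, I §2.2] -/
theorem finite_range_of_compactSpace (φ : C(G, D)) : (Set.range φ).Finite :=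
  (isCompact_range φ.continuous).finite_of_discrete

end Finite

section Directed

variable {Λ : Type*} [Semiring Λ] {D : Type*} [AddCommMonoid D] [Module Λ D] {ι : Type*}
  (N : ι → Submodule Λ D)

/-- A finite subset of a directed union `D = ⋃ N i` of submodules lies in one `N i`.
[cite: SerreGaloisCohomology1997, I §2.2 Prop. 8] -/
theorem exists_subset_of_finite (hdir : Directed (· ≤ ·) N) (hex : ∀ d : D, ∃ i, d ∈ N i)
    {s : Set D} (hs : s.Finite) : ∃ i, s ⊆ N i := by
  classical
  haveI : Nonempty ι := ⟨(hex 0).choose⟩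
  choose c hc using hex
  obtain ⟨z, hz⟩ := hdir.finset_le (hs.toFinset.image c)
  exact ⟨z, fun d hd => hz (c d) (Finset.mem_image_of_mem c (hs.mem_toFinset.mpr hd)) (hc d)⟩

end Directed

/-! ### §1. The engine: lifting cocycles along ONE injective morphism of discrete modules -/

section Engine

variable {Λ : Type*} [CommRing Λ] [TopologicalSpace Λ]
  {G : Type u} [Group G] [TopologicalSpace G]
  {D : Type u} [AddCommGroup D] [Module Λ D] [TopologicalSpace D]
  [IsTopologicalAddGroup D] [ContinuousSMul Λ D]
  {M : Type u} [AddCommGroup M] [Module Λ M] [TopologicalSpace M]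
  [IsTopologicalAddGroup M] [ContinuousSMul Λ M]
  {ρ : ContinuousRep G Λ D} {σ : ContinuousRep G Λ M}

/-- **A continuous `1`-cocycle with values in the image of an injective morphism `f : M → D` of
`G`-modules, `D` discrete, lifts along `f`** (`f⁻¹ ∘ φ` is continuous because `D` is discrete, and
is a crossed homomorphism by injectivity of `f`).
[cite: SerreGaloisCohomology1997, I §2.2 Prop. 8] -/
theorem exists_pullback_eq_of_range_subset [DiscreteTopology D] (f : σ.toTopRep ⟶ ρ.toTopRep)
    (hf : Injective f.hom) (φ : contOneCocycles ρ.toTopRep) (hφ : Set.range φ.1 ⊆ Set.range f.hom) :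
    ∃ ψ : contOneCocycles σ.toTopRep,
      contOneCocycles.pullback (ContinuousMonoidHom.id G) (resIdHom f) ψ = φ := by
  classical
  have hval : ∀ g, f.hom (Function.invFun f.hom (φ.1 g)) = φ.1 g := fun g =>
    Function.invFun_eq (hφ ⟨g, rfl⟩)
  have hcont : Continuous fun g => Function.invFun f.hom (φ.1 g) :=
    (continuous_of_discreteTopology (f := Function.invFun f.hom)).comp φ.1.continuous
  refine ⟨⟨⟨fun g => Function.invFun f.hom (φ.1 g), hcont⟩, fun g h => hf ?_⟩, ?_⟩
  · change f.hom (Function.invFun f.hom (φ.1 (g * h))) =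
      f.hom (Function.invFun f.hom (φ.1 g) + σ.toTopRep.ρ g (Function.invFun f.hom (φ.1 h)))
    rw [map_add, TopRep.hom_comm_apply f g, hval, hval, hval]
    exact φ.2 g h
  · exact Subtype.ext (ContinuousMap.ext fun g => (pullback_id_resIdHom_apply _ _ g).trans (hval g))

variable [IsTopologicalGroup G]

/-- Hence **a class of `H¹(G, D)` represented by a cocycle valued in `im f` lies in `im H¹(f)`**.
[cite: SerreGaloisCohomology1997, I §2.2 Prop. 8] -/
theorem exists_cohomologyMap_eq_oneCocycleClass_of_range_subset [DiscreteTopology D]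
    (f : σ.toTopRep ⟶ ρ.toTopRep) (hf : Injective f.hom) (φ : contOneCocycles ρ.toTopRep)
    (hφ : Set.range φ.1 ⊆ Set.range f.hom) :
    ∃ y : continuousCohomology 1 σ.toTopRep,
      cohomologyMap f 1 y = oneCocycleClass ρ.toTopRep φ := by
  obtain ⟨ψ, hψ⟩ := exists_pullback_eq_of_range_subset f hf φ hφ
  exact ⟨oneCocycleClass _ ψ, by rw [cohomologyMap_oneCocycleClass, hψ]⟩

/-- Unfolding **`H¹(f)[ψ] = 0`**: `f ∘ ψ` is principal in `D`, `f (ψ σ) = σ v - v`.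
[cite: SerreGaloisCohomology1997, I §5.1] -/
theorem cohomologyMap_oneCocycleClass_eq_zero_iff (f : σ.toTopRep ⟶ ρ.toTopRep)
    (ψ : contOneCocycles σ.toTopRep) :
    cohomologyMap f 1 (oneCocycleClass σ.toTopRep ψ) = 0 ↔
      ∃ v : D, ∀ g, f.hom (ψ.1 g) = ρ g v - v := by
  rw [cohomologyMap_oneCocycleClass, oneCocycleClass_eq_zero_iff]
  rfl

/-- **If the principal witness lies in `im f` (`f` injective), the class vanishes in `H¹(G, M)`.**
[cite: SerreGaloisCohomology1997, I §2.2 Prop. 8] -/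
theorem oneCocycleClass_eq_zero_of_apply_eq (f : σ.toTopRep ⟶ ρ.toTopRep) (hf : Injective f.hom)
    (ψ : contOneCocycles σ.toTopRep) (w : M) (hw : ∀ g, f.hom (ψ.1 g) = ρ g (f.hom w) - f.hom w) :
    oneCocycleClass σ.toTopRep ψ = 0 := by
  refine (oneCocycleClass_eq_zero_iff _ _).2 ⟨w, fun g => hf ?_⟩
  rw [hw g, map_sub, TopRep.hom_comm_apply f g]
  rfl

/-- **`H¹(b) ∘ H¹(a) = H¹(c)` on classes for a pointwise composite `b ∘ a = c`** of morphisms of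
topological representations (cocycle-level; every degree: the tree's
`cohomologyMap_comp_apply_of_eq`). [cite: SerreGaloisCohomology1997, I §2.4] -/
theorem cohomologyMap_comp_apply_of_eq_one {M' : Type u} [AddCommGroup M'] [Module Λ M']
    [TopologicalSpace M'] [IsTopologicalAddGroup M'] [ContinuousSMul Λ M'] {σ' : ContinuousRep G Λ M'}
    (a : σ.toTopRep ⟶ σ'.toTopRep) (b : σ'.toTopRep ⟶ ρ.toTopRep) (c : σ.toTopRep ⟶ ρ.toTopRep)
    (habc : ∀ m, b.hom (a.hom m) = c.hom m) (y : continuousCohomology 1 σ.toTopRep) :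
    cohomologyMap b 1 (cohomologyMap a 1 y) = cohomologyMap c 1 y := by
  obtain ⟨ψ, rfl⟩ := oneCocycleClass_surjective _ y
  rw [cohomologyMap_oneCocycleClass, cohomologyMap_oneCocycleClass, cohomologyMap_oneCocycleClass]
  exact congrArg _ (Subtype.ext (ContinuousMap.ext fun g => habc _))

omit [IsTopologicalGroup G] in
/-- **Degree `2`: a continuous inhomogeneous `2`-cocycle with values in the image of an injective
morphism `f : M → D` of `G`-modules, `D` discrete, lifts along `f`.**
[cite: SerreGaloisCohomology1997, I §2.2 Prop. 8] -/
theorem exists_pullback₂_eq_of_range_subset [DiscreteTopology D] (f : σ.toTopRep ⟶ ρ.toTopRep)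
    (hf : Injective f.hom) (c : contTwoCocycles ρ.toTopRep) (hc : Set.range c.1 ⊆ Set.range f.hom) :
    ∃ ψ : contTwoCocycles σ.toTopRep,
      contTwoCocycles.pullback (ContinuousMonoidHom.id G) (resIdHom f) ψ = c := by
  classical
  have hval : ∀ x, f.hom (Function.invFun f.hom (c.1 x)) = c.1 x := fun x =>
    Function.invFun_eq (hc ⟨x, rfl⟩)
  have hcont : Continuous fun x => Function.invFun f.hom (c.1 x) :=
    (continuous_of_discreteTopology (f := Function.invFun f.hom)).comp c.1.continuous
  refine ⟨⟨⟨fun x => Function.invFun f.hom (c.1 x), hcont⟩, fun s t v => hf ?_⟩, ?_⟩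
  · change f.hom (σ.toTopRep.ρ s (Function.invFun f.hom (c.1 (t, v))) +
        Function.invFun f.hom (c.1 (s, t * v))) =
      f.hom (Function.invFun f.hom (c.1 (s * t, v)) + Function.invFun f.hom (c.1 (s, t)))
    rw [map_add, map_add, TopRep.hom_comm_apply f s, hval, hval, hval, hval]
    exact c.2 s t v
  · refine Subtype.ext (ContinuousMap.ext fun x => ?_)
    obtain ⟨s, t⟩ := x
    exact (pullback₂_id_resIdHom_apply _ _ s t).trans (hval (s, t))

variable [LocallyCompactSpace G]

/-- Hence a class of `H²(G, D)` represented by a `2`-cocycle valued in `im f` lies in `im H²(f)`.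
[cite: SerreGaloisCohomology1997, I §2.2 Prop. 8] -/
theorem exists_cohomologyMap_eq_twoCocycleClass_of_range_subset [DiscreteTopology D]
    (f : σ.toTopRep ⟶ ρ.toTopRep) (hf : Injective f.hom) (c : contTwoCocycles ρ.toTopRep)
    (hc : Set.range c.1 ⊆ Set.range f.hom) :
    ∃ y : continuousCohomology 2 σ.toTopRep,
      cohomologyMap f 2 y = twoCocycleClass ρ.toTopRep c := by
  obtain ⟨ψ, hψ⟩ := exists_pullback₂_eq_of_range_subset f hf c hc
  exact ⟨twoCocycleClass _ ψ, by rw [cohomologyMap_twoCocycleClass, hψ]⟩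

/-- Unfolding **`H²(f)[ψ] = 0`**: `f ∘ ψ` is the coboundary of a continuous `b : G → D`.
[cite: SerreGaloisCohomology1997, I §2.3] -/
theorem cohomologyMap_twoCocycleClass_eq_zero_iff (f : σ.toTopRep ⟶ ρ.toTopRep)
    (ψ : contTwoCocycles σ.toTopRep) :
    cohomologyMap f 2 (twoCocycleClass σ.toTopRep ψ) = 0 ↔
      ∃ b : C(G, D), ∀ s t : G, f.hom (ψ.1 (s, t)) = ρ s (b t) - b (s * t) + b s := by
  rw [cohomologyMap_twoCocycleClass, twoCocycleClass_eq_zero_iff]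
  rfl

/-- **If the coboundary witness `b` is valued in `im f` (`f` injective), the class vanishes in
`H²(G, M)`.** [cite: SerreGaloisCohomology1997, I §2.2 Prop. 8] -/
theorem twoCocycleClass_eq_zero_of_apply_eq (f : σ.toTopRep ⟶ ρ.toTopRep) (hf : Injective f.hom)
    (ψ : contTwoCocycles σ.toTopRep) (b : C(G, M))
    (hb : ∀ s t : G, f.hom (ψ.1 (s, t)) = ρ s (f.hom (b t)) - f.hom (b (s * t)) + f.hom (b s)) :
    twoCocycleClass σ.toTopRep ψ = 0 := by
  refine (twoCocycleClass_eq_zero_iff _ _).2 ⟨b, fun s t => hf ?_⟩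
  rw [hb s t, map_add, map_sub, TopRep.hom_comm_apply f s]
  rfl

/-- **`H²(b) ∘ H²(a) = H²(c)` on classes for a pointwise composite `b ∘ a = c`.**
[cite: SerreGaloisCohomology1997, I §2.4] -/
theorem cohomologyMap_comp_apply_of_eq_two {M' : Type u} [AddCommGroup M'] [Module Λ M']
    [TopologicalSpace M'] [IsTopologicalAddGroup M'] [ContinuousSMul Λ M'] {σ' : ContinuousRep G Λ M'}
    (a : σ.toTopRep ⟶ σ'.toTopRep) (b : σ'.toTopRep ⟶ ρ.toTopRep) (c : σ.toTopRep ⟶ ρ.toTopRep)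
    (habc : ∀ m, b.hom (a.hom m) = c.hom m) (y : continuousCohomology 2 σ.toTopRep) :
    cohomologyMap b 2 (cohomologyMap a 2 y) = cohomologyMap c 2 y := by
  obtain ⟨ψ, rfl⟩ := twoCocycleClass_surjective _ y
  rw [cohomologyMap_twoCocycleClass, cohomologyMap_twoCocycleClass, cohomologyMap_twoCocycleClass]
  exact congrArg _ (Subtype.ext (ContinuousMap.ext fun x => habc _))

end Engine

/-! ### §2. Directed unions of `G`-stable submodules: `Hⁿ(G, ⋃ N i) = ⋃ im Hⁿ(G, N i)`, `n = 1, 2`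
(morphisms quantified with a pointwise specification `f m = m`, see the module docstring) -/

section Colimit

variable {Λ : Type*} [CommRing Λ] [TopologicalSpace Λ]
  {G : Type u} [Group G] [TopologicalSpace G] [IsTopologicalGroup G]
  {D : Type u} [AddCommGroup D] [Module Λ D] [TopologicalSpace D] [DiscreteTopology D]
  [IsTopologicalAddGroup D] [ContinuousSMul Λ D]
  (ρ : ContinuousRep G Λ D) {ι : Type*} (N : ι → Submodule Λ D)
  (hN : ∀ (i : ι) (g : G), N i ≤ (N i).comap (ρ g))

/-- **`H¹(G, D) = ⋃_i im H¹(G, N i)`** for a compact `G`, a discrete `D` and a directed exhaustive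
family of `G`-stable submodules `N i` (Serre I §2.2 Prop. 8 in degree `1`, element form): every
class is `H¹(f) y` for some `i`, some `y ∈ H¹(G, N i)` and EVERY morphism `f : N i → D` with
`f m = m`. [cite: SerreGaloisCohomology1997, I §2.2 Prop. 8] -/
theorem exists_cohomologyMap_eq_one [CompactSpace G] (hdir : Directed (· ≤ ·) N)
    (hex : ∀ d : D, ∃ i, d ∈ N i) (x : continuousCohomology 1 ρ.toTopRep) :
    ∃ (i : ι) (y : continuousCohomology 1 (ρ.subrepresentation (N i) (hN i)).toTopRep),
      ∀ (f : (ρ.subrepresentation (N i) (hN i)).toTopRep ⟶ ρ.toTopRep),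
        (∀ m, f.hom m = (m : D)) → cohomologyMap f 1 y = x := by
  obtain ⟨φ, rfl⟩ := oneCocycleClass_surjective _ x
  obtain ⟨i, hi⟩ := exists_subset_of_finite N hdir hex (finite_range_of_compactSpace φ.1)
  refine ⟨i, oneCocycleClass _ ⟨⟨fun g => ⟨φ.1 g, hi ⟨g, rfl⟩⟩, φ.1.continuous.subtype_mk _⟩,
    fun g h => Subtype.ext ?_⟩, fun f hf => ?_⟩
  · exact φ.2 g h
  · rw [cohomologyMap_oneCocycleClass]
    exact congrArg _ (Subtype.ext (ContinuousMap.ext fun g => hf _))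

omit [DiscreteTopology D] in
/-- **A class of `H¹(G, N i)` vanishing in `H¹(G, D)` vanishes in some `H¹(G, N j)`, `N i ≤ N j`**
(the coboundary witness `v ∈ D` lies in some `N j₀`; take `N j` above `N i` and `N j₀`), for
every transition morphism `t : N i → N j` with `t m = m`. [cite: SerreGaloisCohomology1997, I §2.2 Prop. 8] -/
theorem exists_cohomologyMap_eq_zero_one (hdir : Directed (· ≤ ·) N)
    (hex : ∀ d : D, ∃ i, d ∈ N i) {i : ι}
    (y : continuousCohomology 1 (ρ.subrepresentation (N i) (hN i)).toTopRep)
    (f : (ρ.subrepresentation (N i) (hN i)).toTopRep ⟶ ρ.toTopRep) (hf : ∀ m, f.hom m = (m : D))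
    (hy : cohomologyMap f 1 y = 0) :
    ∃ (j : ι) (_ : N i ≤ N j),
      ∀ (t : (ρ.subrepresentation (N i) (hN i)).toTopRep ⟶ (ρ.subrepresentation (N j) (hN j)).toTopRep),
        (∀ m, (t.hom m : D) = m) → cohomologyMap t 1 y = 0 := by
  obtain ⟨ψ, rfl⟩ := oneCocycleClass_surjective _ y
  obtain ⟨v, hv⟩ := (cohomologyMap_oneCocycleClass_eq_zero_iff f ψ).1 hy
  obtain ⟨j₀, hj₀⟩ := hex v
  obtain ⟨j, hij, hj₀j⟩ := hdir i j₀
  refine ⟨j, hij, fun t ht => ?_⟩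
  rw [cohomologyMap_oneCocycleClass, oneCocycleClass_eq_zero_iff]
  refine ⟨⟨v, hj₀j hj₀⟩, fun g => Subtype.ext ?_⟩
  change (t.hom (ψ.1 g) : D) = ρ g v - v
  rw [ht]
  exact (hf _).symm.trans (hv g)

/-- **Two level classes with the same image in `H¹(G, D)` agree at a common deeper level.**
[cite: SerreGaloisCohomology1997, I §2.2 Prop. 8] -/
theorem exists_cohomologyMap_eq_eq_one (hdir : Directed (· ≤ ·) N)
    (hex : ∀ d : D, ∃ i, d ∈ N i) {i i' : ι}
    (y : continuousCohomology 1 (ρ.subrepresentation (N i) (hN i)).toTopRep)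
    (y' : continuousCohomology 1 (ρ.subrepresentation (N i') (hN i')).toTopRep)
    (f : (ρ.subrepresentation (N i) (hN i)).toTopRep ⟶ ρ.toTopRep) (hf : ∀ m, f.hom m = (m : D))
    (f' : (ρ.subrepresentation (N i') (hN i')).toTopRep ⟶ ρ.toTopRep) (hf' : ∀ m, f'.hom m = (m : D))
    (h : cohomologyMap f 1 y = cohomologyMap f' 1 y') :
    ∃ (j : ι) (_ : N i ≤ N j) (_ : N i' ≤ N j),
      ∀ (t : (ρ.subrepresentation (N i) (hN i)).toTopRep ⟶ (ρ.subrepresentation (N j) (hN j)).toTopRep)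
        (t' : (ρ.subrepresentation (N i') (hN i')).toTopRep ⟶
          (ρ.subrepresentation (N j) (hN j)).toTopRep),
        (∀ m, (t.hom m : D) = m) → (∀ m, (t'.hom m : D) = m) →
          cohomologyMap t 1 y = cohomologyMap t' 1 y' := by
  obtain ⟨k, hik, hi'k⟩ := hdir i i'
  let S := fun l => (ρ.subrepresentation (N l) (hN l)).toTopRep
  let a : S i ⟶ S k := TopRep.ofHom
    ⟨⟨Submodule.inclusion hik, continuous_of_discreteTopology⟩, fun g ↦ by ext m; rfl⟩
  let a' : S i' ⟶ S k := TopRep.ofHom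
    ⟨⟨Submodule.inclusion hi'k, continuous_of_discreteTopology⟩, fun g ↦ by ext m; rfl⟩
  let fk : S k ⟶ ρ.toTopRep := TopRep.ofHom ⟨(N k).subtypeL, fun g ↦ by ext m; rfl⟩
  have hk : cohomologyMap fk 1 (cohomologyMap a 1 y - cohomologyMap a' 1 y') = 0 := by
    rw [map_sub, cohomologyMap_comp_apply_of_eq_one a fk f (fun _ => (hf _).symm),
      cohomologyMap_comp_apply_of_eq_one a' fk f' (fun _ => (hf' _).symm), h, sub_self]
  obtain ⟨j, hkj, hj⟩ := exists_cohomologyMap_eq_zero_one ρ N hN hdir hex _ fk (fun _ => rfl) hk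
  refine ⟨j, hik.trans hkj, hi'k.trans hkj, fun t t' ht ht' => ?_⟩
  let b : S k ⟶ S j := TopRep.ofHom
    ⟨⟨Submodule.inclusion hkj, continuous_of_discreteTopology⟩, fun g ↦ by ext m; rfl⟩
  have hb := hj b (fun _ => rfl)
  rw [map_sub, sub_eq_zero,
    cohomologyMap_comp_apply_of_eq_one a b t (fun m => Subtype.ext (ht m).symm),
    cohomologyMap_comp_apply_of_eq_one a' b t' (fun m => Subtype.ext (ht' m).symm)] at hb
  exact hb

variable [LocallyCompactSpace G]

/-- **`H²(G, D) = ⋃_i im H²(G, N i)`** for a compact `G`, a discrete `D` and a directed exhaustive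
family of `G`-stable submodules (Serre I §2.2 Prop. 8 in degree `2`, element form: a continuous
`2`-cocycle on the compact `G × G` has finite image). [cite: SerreGaloisCohomology1997, I §2.2 Prop. 8] -/
theorem exists_cohomologyMap_eq_two [CompactSpace G] (hdir : Directed (· ≤ ·) N)
    (hex : ∀ d : D, ∃ i, d ∈ N i) (x : continuousCohomology 2 ρ.toTopRep) :
    ∃ (i : ι) (y : continuousCohomology 2 (ρ.subrepresentation (N i) (hN i)).toTopRep),
      ∀ (f : (ρ.subrepresentation (N i) (hN i)).toTopRep ⟶ ρ.toTopRep),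
        (∀ m, f.hom m = (m : D)) → cohomologyMap f 2 y = x := by
  obtain ⟨c, rfl⟩ := twoCocycleClass_surjective _ x
  obtain ⟨i, hi⟩ := exists_subset_of_finite N hdir hex (finite_range_of_compactSpace c.1)
  refine ⟨i, twoCocycleClass _ ⟨⟨fun x => ⟨c.1 x, hi ⟨x, rfl⟩⟩, c.1.continuous.subtype_mk _⟩,
    fun s t v => Subtype.ext ?_⟩, fun f hf => ?_⟩
  · exact c.2 s t v
  · rw [cohomologyMap_twoCocycleClass]
    exact congrArg _ (Subtype.ext (ContinuousMap.ext fun x => hf _))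

/-- **A class of `H²(G, N i)` vanishing in `H²(G, D)` vanishes in some `H²(G, N j)`, `N i ≤ N j`**
(the coboundary witness is a continuous `1`-cochain `b : G → D`, of finite image, hence with values
in some `N j₀`). [cite: SerreGaloisCohomology1997, I §2.2 Prop. 8] -/
theorem exists_cohomologyMap_eq_zero_two [CompactSpace G] (hdir : Directed (· ≤ ·) N)
    (hex : ∀ d : D, ∃ i, d ∈ N i) {i : ι}
    (y : continuousCohomology 2 (ρ.subrepresentation (N i) (hN i)).toTopRep)
    (f : (ρ.subrepresentation (N i) (hN i)).toTopRep ⟶ ρ.toTopRep) (hf : ∀ m, f.hom m = (m : D))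
    (hy : cohomologyMap f 2 y = 0) :
    ∃ (j : ι) (_ : N i ≤ N j),
      ∀ (t : (ρ.subrepresentation (N i) (hN i)).toTopRep ⟶ (ρ.subrepresentation (N j) (hN j)).toTopRep),
        (∀ m, (t.hom m : D) = m) → cohomologyMap t 2 y = 0 := by
  obtain ⟨ψ, rfl⟩ := twoCocycleClass_surjective _ y
  obtain ⟨b, hb⟩ := (cohomologyMap_twoCocycleClass_eq_zero_iff f ψ).1 hy
  obtain ⟨j₀, hj₀⟩ := exists_subset_of_finite N hdir hex (finite_range_of_compactSpace b)
  obtain ⟨j, hij, hj₀j⟩ := hdir i j₀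
  refine ⟨j, hij, fun t ht => ?_⟩
  rw [cohomologyMap_twoCocycleClass, twoCocycleClass_eq_zero_iff]
  refine ⟨⟨fun g => ⟨b g, hj₀j (hj₀ ⟨g, rfl⟩)⟩, b.continuous.subtype_mk _⟩,
    fun s u => Subtype.ext ?_⟩
  change (t.hom (ψ.1 (s, u)) : D) = ρ s (b u) - b (s * u) + b s
  rw [ht]
  exact (hf _).symm.trans (hb s u)

/-- **Two level classes with the same image in `H²(G, D)` agree at a common deeper level.**
[cite: SerreGaloisCohomology1997, I §2.2 Prop. 8] -/
theorem exists_cohomologyMap_eq_eq_two [CompactSpace G] (hdir : Directed (· ≤ ·) N)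
    (hex : ∀ d : D, ∃ i, d ∈ N i) {i i' : ι}
    (y : continuousCohomology 2 (ρ.subrepresentation (N i) (hN i)).toTopRep)
    (y' : continuousCohomology 2 (ρ.subrepresentation (N i') (hN i')).toTopRep)
    (f : (ρ.subrepresentation (N i) (hN i)).toTopRep ⟶ ρ.toTopRep) (hf : ∀ m, f.hom m = (m : D))
    (f' : (ρ.subrepresentation (N i') (hN i')).toTopRep ⟶ ρ.toTopRep) (hf' : ∀ m, f'.hom m = (m : D))
    (h : cohomologyMap f 2 y = cohomologyMap f' 2 y') :
    ∃ (j : ι) (_ : N i ≤ N j) (_ : N i' ≤ N j),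
      ∀ (t : (ρ.subrepresentation (N i) (hN i)).toTopRep ⟶ (ρ.subrepresentation (N j) (hN j)).toTopRep)
        (t' : (ρ.subrepresentation (N i') (hN i')).toTopRep ⟶
          (ρ.subrepresentation (N j) (hN j)).toTopRep),
        (∀ m, (t.hom m : D) = m) → (∀ m, (t'.hom m : D) = m) →
          cohomologyMap t 2 y = cohomologyMap t' 2 y' := by
  obtain ⟨k, hik, hi'k⟩ := hdir i i'
  let S := fun l => (ρ.subrepresentation (N l) (hN l)).toTopRep
  let a : S i ⟶ S k := TopRep.ofHom
    ⟨⟨Submodule.inclusion hik, continuous_of_discreteTopology⟩, fun g ↦ by ext m; rfl⟩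
  let a' : S i' ⟶ S k := TopRep.ofHom
    ⟨⟨Submodule.inclusion hi'k, continuous_of_discreteTopology⟩, fun g ↦ by ext m; rfl⟩
  let fk : S k ⟶ ρ.toTopRep := TopRep.ofHom ⟨(N k).subtypeL, fun g ↦ by ext m; rfl⟩
  have hk : cohomologyMap fk 2 (cohomologyMap a 2 y - cohomologyMap a' 2 y') = 0 := by
    rw [map_sub, cohomologyMap_comp_apply_of_eq_two a fk f (fun _ => (hf _).symm),
      cohomologyMap_comp_apply_of_eq_two a' fk f' (fun _ => (hf' _).symm), h, sub_self]
  obtain ⟨j, hkj, hj⟩ := exists_cohomologyMap_eq_zero_two ρ N hN hdir hex _ fk (fun _ => rfl) hk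
  refine ⟨j, hik.trans hkj, hi'k.trans hkj, fun t t' ht ht' => ?_⟩
  let b : S k ⟶ S j := TopRep.ofHom
    ⟨⟨Submodule.inclusion hkj, continuous_of_discreteTopology⟩, fun g ↦ by ext m; rfl⟩
  have hb := hj b (fun _ => rfl)
  rw [map_sub, sub_eq_zero,
    cohomologyMap_comp_apply_of_eq_two a b t (fun m => Subtype.ext (ht m).symm),
    cohomologyMap_comp_apply_of_eq_two a' b t' (fun m => Subtype.ext (ht' m).symm)] at hb
  exact hb

end Colimit

end Literature.NumberTheory.GaloisRepresentations.ContinuousRep
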